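import Summits.NavierStokesRegularity.NavierStokesRegularity.Theorems.TaoForcedUniqueness.Negative.SerrinEnstrophyVoidWeakForm

/-!
# KJ-6 (6/9): the weak gradient of the witness and the ENERGY bookkeeping (`uW_weakGrad_energy`)

Cell `ns-blowup`, seat `ns-blowup-refuter` (g10 blueprint, g11 kernel), KILLSHEET §XXIV rows KJ-6/KJ-7,
part 6/9 of the kernel certificate `¬ Literature.Analysis.FluidPDE.Sohr2001_serrinClass_enstrophyBound(_global)`
(final file `SohrSerrinEnstrophyCountableJunk.lean` in this directory, which carries the full account and the
classification). LABEL: refuter construction (explicit data + proved lemmas; no named facts, no `sorry`).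
WHAT THIS IS NOT: not Navier–Stokes evidence and not a statement about Sohr's printed theorem — a hygiene
refutation of two facts AS TYPED (slice-wise force class `MemLqLp 2 2`, one outer Bochner integral in the
weak form); nothing here mentions the summit.

Content: `GW = fderiv ℝ (u t)` is a weak gradient of every slice, `∫₀ᵀ ∫ ‖G‖² = ‖∇U‖₂² ∫ t² λ(t)² < ∞`;
`‖U_c‖₂² = ‖U‖₂²`, `c₁ ‖U‖₂² = ‖∇U‖₂²`; kinetic energy `½ t² ‖U‖₂²` off `T/2` (`≤` everywhere); the HONEST work term
`∫⟪f τ, u τ⟫ = κ(τ) τ ‖U‖₂²` for `τ ≠ T/2` (`J.orth` kills the junk part exactly); the dissipation and work integrals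
in closed form and the identity `energy_core`; BOTH energy (in)equalities of `IsLerayHopfOn.weakGrad_energy`
(`uW_energyIneq`: equality off `T/2`, strict at `T/2` where `u = 0`), assembled as `uW_weakGrad_energy`.
-/

noncomputable section

namespace Summit.NavierStokesRegularity.ForcedUniquenessHygiene.KJ6

open MeasureTheory Set Function Filter Topology Metric
open scoped ENNReal NNReal RealInnerProductSpace ContDiff Laplacian
open Literature.Analysis.FluidPDE Literature.Analysis.FunctionSpaces

/-- Euclidean `ℝ³` (file-local notation, as in the `Literature.Analysis.FluidPDE` files). -/
local notation "ℝ³" => EuclideanSpace ℝ (Fin 3)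

variable {Pr : Profile} (J : JunkFamily Pr)

section Hyps
variable {P : ℕ → Set ℝ} {ℓ : ℝ → ℕ} {ν T : ℝ}

/-! ### The weak gradient of the witness (conjuncts 1–2 of `weakGrad_energy`) and the energy bookkeeping -/

/-- The slice-wise classical gradient of the witness, `G t = fderiv ℝ (u t)`. -/
def GW (Pr : Profile) (T t : ℝ) : ℝ³ → ℝ³ →L[ℝ] ℝ³ := fderiv ℝ (uW Pr T t)

/-- Conjunct 1 of `weakGrad_energy`: `G t` is a weak gradient of `u t` (for every `t`). -/
theorem hasWeakGradient_uW (T t : ℝ) : HasWeakGradient (uW Pr T t) (GW Pr T t) :=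
  hasWeakGradient_fderiv_of_contDiff (contDiff_uW (Pr := Pr) T t)

/-- `∫⁻ ‖∇u(t)‖² = eWeakGradL2Sq (u t)`. -/
theorem lintegral_GW_eq (T t : ℝ) :
    ∫⁻ x, ENNReal.ofReal (frobeniusNormSq (GW Pr T t x)) = eWeakGradL2Sq (uW Pr T t) :=
  (eWeakGradL2Sq_eq_of_hasWeakGradient (hasWeakGradient_uW (Pr := Pr) T t)).symm

/-- `‖∇u(t)‖₂² ≤ T² λ(t)² ‖∇U‖₂²` for `t ∈ (0,T)`, `t ≠ T/2`. -/
theorem lintegral_GW_le {T t : ℝ} (ht : t ∈ Ioo 0 T) (ht2 : t ≠ T / 2) :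
    ∫⁻ x, ENNReal.ofReal (frobeniusNormSq (GW Pr T t x)) ≤
      ENNReal.ofReal (T ^ 2 * lamSq T t) * eWeakGradL2Sq Pr.U := by
  rw [lintegral_GW_eq, eWeakGradL2Sq_uW Pr ht2 ht.1.ne']
  have h : t ^ 2 * lamSq T t ≤ T ^ 2 * lamSq T t :=
    mul_le_mul_of_nonneg_right (pow_le_pow_left₀ ht.1.le ht.2.le 2) (lamSq_pos T t).le
  exact mul_le_mul' (ENNReal.ofReal_le_ofReal h) le_rfl

/-- Conjunct 2 of `weakGrad_energy`: `∫₀ᵀ ‖∇u‖₂² ≤ T² ‖∇U‖₂² ∫₀ᵀ λ² < ∞`. -/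
theorem lintegral_GW_lt_top (T : ℝ) :
    ∫⁻ t in Ioo 0 T, ∫⁻ x, ENNReal.ofReal (frobeniusNormSq (GW Pr T t x)) < ⊤ := by
  have hne : ∀ᵐ t ∂(volume.restrict (Ioo 0 T)), t ≠ T / 2 :=
    ae_restrict_of_ae (by simp [ae_iff])
  have hbound : ∀ᵐ t ∂(volume.restrict (Ioo 0 T)),
      ∫⁻ x, ENNReal.ofReal (frobeniusNormSq (GW Pr T t x)) ≤
        ENNReal.ofReal (T ^ 2 * lamSq T t) * eWeakGradL2Sq Pr.U := by
    filter_upwards [ae_restrict_mem measurableSet_Ioo, hne] with t ht ht2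
    exact lintegral_GW_le (Pr := Pr) ht ht2
  refine lt_of_le_of_lt (lintegral_mono_ae hbound) ?_
  rw [lintegral_mul_const _ ((measurable_lamSq T).const_mul _).ennreal_ofReal]
  refine ENNReal.mul_lt_top ?_ Pr.grad_lt_top
  have hint : Integrable (fun t => T ^ 2 * lamSq T t) (volume.restrict (Ioo 0 T)) :=
    ((memLp_lamSq T 0 T).integrable one_le_two).const_mul _
  have h2 : ∫⁻ t in Ioo 0 T, ‖T ^ 2 * lamSq T t‖ₑ < ⊤ := hint.hasFiniteIntegral
  exact lt_of_le_of_lt (lintegral_mono fun t => Real.ofReal_le_enorm _) h2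

/-! ### Energy bookkeeping of the witness (the two energy (in)equalities, PROVED) -/

/-- Dilation preserves `∫‖·‖²`. -/
theorem integral_norm_sq_dilate {c : ℝ} (hc : 0 < c) :
    ∫ x, ‖dilate c Pr.U x‖ ^ 2 = ∫ x, ‖Pr.U x‖ ^ 2 := by
  have h1 : ∀ x, ‖dilate c Pr.U x‖ ^ 2 = c ^ 3 * ‖Pr.U (c • x)‖ ^ 2 := by
    intro x
    rw [JunkBuild.dilate_apply, norm_smul, norm_smul, Real.norm_of_nonneg (Real.sqrt_nonneg c),
      Real.norm_of_nonneg hc.le]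
    simp only [mul_pow, Real.sq_sqrt hc.le]
    ring
  have h2 : ∫ x, ‖Pr.U (c • x)‖ ^ 2 = (c ^ 3)⁻¹ * ∫ x, ‖Pr.U x‖ ^ 2 := by
    have := Measure.integral_comp_smul_of_nonneg (μ := volume) (fun y => ‖Pr.U y‖ ^ 2) c
      (hR := hc.le)
    simpa [finrank_euclideanSpace_fin] using this
  simp_rw [h1]
  rw [integral_const_mul, h2, ← mul_assoc, mul_inv_cancel₀ (pow_ne_zero 3 hc.ne'), one_mul]

/-- `A = ∫‖U‖² > 0`. -/
theorem integral_norm_sq_profile_pos : 0 < ∫ x, ‖Pr.U x‖ ^ 2 := by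
  rw [← integral_norm_sq_dilate (Pr := Pr) one_pos]
  have h := JunkBuild.nU_pos Pr one_pos
  unfold JunkBuild.nU at h
  simp_rw [real_inner_self_eq_norm_sq] at h
  exact h

/-- `c₁ · ∫‖U‖² = ‖∇U‖₂²`. -/
theorem c₁_mul_integral : c₁ Pr * ∫ x, ‖Pr.U x‖ ^ 2 = (eWeakGradL2Sq Pr.U).toReal := by
  unfold c₁
  exact div_mul_cancel₀ _ (integral_norm_sq_profile_pos (Pr := Pr)).ne'

/-- Kinetic energy of the witness off `T/2`: `E(u t) = ½ t² ∫‖U‖²`. -/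
theorem kineticEnergy_uW_of_ne {T t : ℝ} (ht : t ≠ T / 2) :
    VectorCalculus.kineticEnergy (uW Pr T t) = 2⁻¹ * t ^ 2 * ∫ x, ‖Pr.U x‖ ^ 2 := by
  rw [VectorCalculus.kineticEnergy, uW, if_neg ht]
  have h : ∀ x, ‖(t • dilate (lam T t) Pr.U) x‖ ^ 2 = t ^ 2 * ‖dilate (lam T t) Pr.U x‖ ^ 2 := by
    intro x; rw [Pi.smul_apply, norm_smul, mul_pow, Real.norm_eq_abs, sq_abs]
  simp_rw [h]
  rw [integral_const_mul, integral_norm_sq_dilate (Pr := Pr) (lam_pos T t), mul_assoc]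

/-- Kinetic energy of the witness: `E(u t) ≤ ½ t² ∫‖U‖²` for every `t` (`= 0` at `T/2`). -/
theorem kineticEnergy_uW_le (T t : ℝ) :
    VectorCalculus.kineticEnergy (uW Pr T t) ≤ 2⁻¹ * t ^ 2 * ∫ x, ‖Pr.U x‖ ^ 2 := by
  rcases eq_or_ne t (T / 2) with h | h
  · have h0 : VectorCalculus.kineticEnergy (uW Pr T t) = 0 := by
      rw [VectorCalculus.kineticEnergy, uW, if_pos h]; simp
    rw [h0]
    exact mul_nonneg (mul_nonneg (by norm_num) (sq_nonneg _)) (integral_nonneg fun _ => sq_nonneg _)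
  · exact (kineticEnergy_uW_of_ne (Pr := Pr) h).le

/-- **Honest work** off `T/2`: `∫⟪f τ, u τ⟫ = κ(τ) τ ∫‖U‖²` — the junk part does no work (`J.orth`). -/
theorem integral_work_of_ne {τ : ℝ} (hτ : τ ≠ T / 2) :
    ∫ x, ⟪fW J ℓ ν T τ x, uW Pr T τ x⟫ = kappa Pr ν T τ * τ * ∫ x, ‖Pr.U x‖ ^ 2 := by
  have hc := lam_pos T τ
  have hU2 : MemLp (dilate (lam T τ) Pr.U) 2 volume := memLp_dilate_two (Pr := Pr) hc
  have hΦ2 : MemLp (J.Φ (lam T τ) (ℓ τ)) 2 volume := J.memLp _ _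
  have h1 : ∀ x, ⟪fW J ℓ ν T τ x, uW Pr T τ x⟫ =
      kappa Pr ν T τ * τ * ⟪dilate (lam T τ) Pr.U x, dilate (lam T τ) Pr.U x⟫ +
        τ * ⟪J.Φ (lam T τ) (ℓ τ) x, dilate (lam T τ) Pr.U x⟫ := by
    intro x
    rw [fW_slice, uW, if_neg hτ]
    simp only [Pi.add_apply, Pi.smul_apply, inner_add_left, real_inner_smul_left,
      real_inner_smul_right]
    ring
  simp_rw [h1]
  rw [integral_add ((integrable_inner_of_memLp_two hU2 hU2).const_mul _)
      ((integrable_inner_of_memLp_two hΦ2 hU2).const_mul _),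
    integral_const_mul, integral_const_mul, J.orth _ _ hc, mul_zero, add_zero,
    ← integral_norm_sq_dilate (Pr := Pr) hc]
  congr 1
  exact integral_congr_ae (Eventually.of_forall fun x => real_inner_self_eq_norm_sq _)

/-- `τ ↦ τ² λ(τ)²` is integrable on bounded intervals. -/
theorem integrableOn_sq_mul_lamSq (T s t : ℝ) :
    IntegrableOn (fun τ => τ ^ 2 * lamSq T τ) (Ioo s t) := by
  have hg : Integrable (lamSq T) (volume.restrict (Ioo s t)) :=
    (memLp_lamSq T s t).integrable one_le_two
  refine hg.bdd_mul (c := (max |s| |t|) ^ 2) (measurable_id.pow_const 2).aestronglyMeasurable ?_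
  filter_upwards [ae_restrict_mem measurableSet_Ioo] with τ hτ
  rw [norm_pow, Real.norm_eq_abs]
  exact pow_le_pow_left₀ (abs_nonneg τ) (abs_le_max_abs_abs hτ.1.le hτ.2.le) 2

/-- **Dissipation** of the witness on `(s,t)`, `0 ≤ s ≤ t`: `∫ₛᵗ‖∇u‖₂² = ‖∇U‖₂² ∫ₛᵗ τ²λ²`. -/
theorem dissipation_toReal {s t : ℝ} (hs : 0 ≤ s) (hst : s ≤ t) :
    (∫⁻ τ in Ioo s t, ∫⁻ x, ENNReal.ofReal (frobeniusNormSq (GW Pr T τ x))).toReal =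
      (∫ τ in s..t, τ ^ 2 * lamSq T τ) * (eWeakGradL2Sq Pr.U).toReal := by
  have hne : ∀ᵐ τ ∂(volume.restrict (Ioo s t)), τ ≠ T / 2 :=
    ae_restrict_of_ae (by simp [ae_iff])
  have h1 : ∫⁻ τ in Ioo s t, ∫⁻ x, ENNReal.ofReal (frobeniusNormSq (GW Pr T τ x)) =
      ∫⁻ τ in Ioo s t, ENNReal.ofReal (τ ^ 2 * lamSq T τ) * eWeakGradL2Sq Pr.U := by
    refine lintegral_congr_ae ?_
    filter_upwards [ae_restrict_mem measurableSet_Ioo, hne] with τ hτ hτ2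
    rw [lintegral_GW_eq, eWeakGradL2Sq_uW Pr hτ2 (hs.trans_lt hτ.1).ne']
  have hnn : 0 ≤ᵐ[volume.restrict (Ioo s t)] fun τ => τ ^ 2 * lamSq T τ :=
    Eventually.of_forall fun τ => mul_nonneg (sq_nonneg τ) (lamSq_pos T τ).le
  have hmeas : Measurable fun τ : ℝ => ENNReal.ofReal (τ ^ 2 * lamSq T τ) :=
    ((measurable_id.pow_const 2).mul (measurable_lamSq T)).ennreal_ofReal
  rw [h1, lintegral_mul_const _ hmeas,
    ← ofReal_integral_eq_lintegral_ofReal (integrableOn_sq_mul_lamSq T s t) hnn, ENNReal.toReal_mul,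
    ENNReal.toReal_ofReal (setIntegral_nonneg measurableSet_Ioo fun τ _ =>
      mul_nonneg (sq_nonneg τ) (lamSq_pos T τ).le),
    intervalIntegral.integral_of_le hst, integral_Ioc_eq_integral_Ioo]

/-- **Work** of the force along the witness on `[s,t]`:
`∫ₛᵗ∫⟪f,u⟫ = ∫‖U‖² (t²-s²)/2 + ν c₁ ∫‖U‖² ∫ₛᵗ τ²λ²`. -/
theorem work_intervalIntegral {s t : ℝ} (hst : s ≤ t) :
    ∫ τ in s..t, ∫ x, ⟪fW J ℓ ν T τ x, uW Pr T τ x⟫ =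
      (∫ x, ‖Pr.U x‖ ^ 2) * ((t ^ 2 - s ^ 2) / 2) +
        ν * c₁ Pr * (∫ x, ‖Pr.U x‖ ^ 2) * ∫ τ in s..t, τ ^ 2 * lamSq T τ := by
  have hne : ∀ᵐ τ ∂(volume : Measure ℝ), τ ≠ T / 2 := by simp [ae_iff]
  have h1 : ∫ τ in s..t, ∫ x, ⟪fW J ℓ ν T τ x, uW Pr T τ x⟫ =
      ∫ τ in s..t, ((∫ x, ‖Pr.U x‖ ^ 2) * τ +
        ν * c₁ Pr * (∫ x, ‖Pr.U x‖ ^ 2) * (τ ^ 2 * lamSq T τ)) := by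
    refine intervalIntegral.integral_congr_ae ?_
    filter_upwards [hne] with τ hτ _
    rw [integral_work_of_ne J hτ, kappa]
    ring
  have hi1 : IntervalIntegrable (fun τ => (∫ x, ‖Pr.U x‖ ^ 2) * τ) volume s t :=
    (by fun_prop : Continuous fun τ : ℝ => (∫ x, ‖Pr.U x‖ ^ 2) * τ).intervalIntegrable _ _
  have hi2 : IntervalIntegrable
      (fun τ => ν * c₁ Pr * (∫ x, ‖Pr.U x‖ ^ 2) * (τ ^ 2 * lamSq T τ)) volume s t :=
    ((intervalIntegrable_iff_integrableOn_Ioo_of_le hst).2 (integrableOn_sq_mul_lamSq T s t)).const_mul _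
  rw [h1, intervalIntegral.integral_add hi1 hi2, intervalIntegral.integral_const_mul,
    intervalIntegral.integral_const_mul, integral_id]

/-- The energy balance of the witness from any `s ≥ 0` (equality off `T/2`, where `E(u) = 0`). -/
theorem energy_core {s t : ℝ} (hs : 0 ≤ s) (hst : s ≤ t) :
    VectorCalculus.kineticEnergy (uW Pr T t) +
        ν * (∫⁻ τ in Ioo s t, ∫⁻ x, ENNReal.ofReal (frobeniusNormSq (GW Pr T τ x))).toReal ≤
      2⁻¹ * s ^ 2 * (∫ x, ‖Pr.U x‖ ^ 2) + ∫ τ in s..t, ∫ x, ⟪fW J ℓ ν T τ x, uW Pr T τ x⟫ := by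
  rw [dissipation_toReal (Pr := Pr) hs hst, work_intervalIntegral J hst]
  have hc := c₁_mul_integral (Pr := Pr)
  have hKE := kineticEnergy_uW_le (Pr := Pr) T t
  have h3 : ν * ((∫ τ in s..t, τ ^ 2 * lamSq T τ) * (eWeakGradL2Sq Pr.U).toReal) =
      ν * c₁ Pr * (∫ x, ‖Pr.U x‖ ^ 2) * ∫ τ in s..t, τ ^ 2 * lamSq T τ := by
    rw [← hc]; ring
  linarith [hKE, h3]

/-- OBLIGATION 2′ of `isLerayHopfOn_uW`: the two ENERGY (IN)EQUALITIES for `G = GW` — they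
hold with EQUALITY off `t = T/2` (`J.orth` makes the work term honest: `∫⟪f τ, u τ⟫ = κ(τ) τ ‖U‖₂²`,
`integral_work_of_ne`; `dissipation_toReal`; `work_intervalIntegral`; the choice of `κ` via
`c₁_mul_integral`), strictly at `t = T/2` where `u = 0` (`kineticEnergy_uW_le`). -/
theorem uW_energyIneq (ℓ : ℝ → ℕ) (hν : 0 < ν) (hT : 0 < T) :
    (∀ t ∈ Icc 0 T, VectorCalculus.kineticEnergy (uW Pr T t) +
        ν * (∫⁻ τ in Ioo 0 t, ∫⁻ x, ENNReal.ofReal (frobeniusNormSq (GW Pr T τ x))).toReal ≤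
        VectorCalculus.kineticEnergy (0 : ℝ³ → ℝ³) +
          ∫ τ in (0 : ℝ)..t, ∫ x, ⟪fW J ℓ ν T τ x, uW Pr T τ x⟫) ∧
      (∀ᵐ s ∂(volume.restrict (Ioo 0 T)), ∀ t ∈ Icc s T, VectorCalculus.kineticEnergy (uW Pr T t) +
        ν * (∫⁻ τ in Ioo s t, ∫⁻ x, ENNReal.ofReal (frobeniusNormSq (GW Pr T τ x))).toReal ≤
          VectorCalculus.kineticEnergy (uW Pr T s) +
            ∫ τ in s..t, ∫ x, ⟪fW J ℓ ν T τ x, uW Pr T τ x⟫) := by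
  have _ := hν; have _ := hT
  refine ⟨fun t ht => ?_, ?_⟩
  · have h := energy_core J (ℓ := ℓ) (ν := ν) (T := T) le_rfl ht.1
    have h0 : VectorCalculus.kineticEnergy (0 : ℝ³ → ℝ³) = 0 := by
      simp [VectorCalculus.kineticEnergy]
    rw [h0]
    simpa using h
  · have hne : ∀ᵐ s ∂(volume.restrict (Ioo 0 T)), s ≠ T / 2 :=
      ae_restrict_of_ae (by simp [ae_iff])
    filter_upwards [ae_restrict_mem measurableSet_Ioo, hne] with s hs hs2 t ht
    rw [kineticEnergy_uW_of_ne (Pr := Pr) hs2]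
    exact energy_core J hs.1.le ht.1

/-- OBLIGATION 2 of `isLerayHopfOn_uW`: the weak gradient `G t = GW = fderiv ℝ (u t)` and `∫∫‖G‖² < ∞`
(`hasWeakGradient_uW`, `lintegral_GW_lt_top`) and the energy (in)equalities (`uW_energyIneq`). Map: `G t = fderiv ℝ (u t)`
(smooth slices), `∫₀ᵀ‖∇u‖₂² = ‖∇U‖₂² ∫ t²λ² < ∞`, and BOTH energy inequalities — they hold with
EQUALITY off `t = T/2` (`J.orth` makes the work term honest: `∫⟪f τ, u τ⟫ = κ(τ) τ ‖U‖₂²` for every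
`τ`; the choice of `κ`), and strictly at `t = T/2` where `u = 0`. Independent of the labelling. -/
theorem uW_weakGrad_energy (ℓ : ℝ → ℕ) (hν : 0 < ν) (hT : 0 < T) :
    ∃ G : ℝ → ℝ³ → ℝ³ →L[ℝ] ℝ³,
      (∀ᵐ t ∂(volume.restrict (Ioo 0 T)), HasWeakGradient (uW Pr T t) (G t)) ∧
      (∫⁻ t in Ioo 0 T, ∫⁻ x, ENNReal.ofReal (frobeniusNormSq (G t x)) < ⊤) ∧
      (∀ t ∈ Icc 0 T, VectorCalculus.kineticEnergy (uW Pr T t) +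
        ν * (∫⁻ τ in Ioo 0 t, ∫⁻ x, ENNReal.ofReal (frobeniusNormSq (G τ x))).toReal ≤
        VectorCalculus.kineticEnergy (0 : ℝ³ → ℝ³) +
          ∫ τ in (0 : ℝ)..t, ∫ x, ⟪fW J ℓ ν T τ x, uW Pr T τ x⟫) ∧
      (∀ᵐ s ∂(volume.restrict (Ioo 0 T)), ∀ t ∈ Icc s T, VectorCalculus.kineticEnergy (uW Pr T t) +
        ν * (∫⁻ τ in Ioo s t, ∫⁻ x, ENNReal.ofReal (frobeniusNormSq (G τ x))).toReal ≤
          VectorCalculus.kineticEnergy (uW Pr T s) +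
            ∫ τ in s..t, ∫ x, ⟪fW J ℓ ν T τ x, uW Pr T τ x⟫) :=
  ⟨GW Pr T, Eventually.of_forall fun t => hasWeakGradient_uW T t, lintegral_GW_lt_top T,
    (uW_energyIneq J ℓ hν hT).1, (uW_energyIneq J ℓ hν hT).2⟩

end Hyps

end Summit.NavierStokesRegularity.ForcedUniquenessHygiene.KJ6
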